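import Mathlib.Algebra.MvPolynomial.Degrees
import Mathlib.Algebra.MvPolynomial.CommRing
import Mathlib.Algebra.MvPolynomial.Eval
import Mathlib.Algebra.Polynomial.AlgebraMap
import Mathlib.Analysis.Complex.Basic
import Mathlib.Analysis.Normed.Unbundled.RingSeminorm
import Mathlib.Analysis.Polynomial.Norm
import Mathlib.LinearAlgebra.Matrix.Determinant.Basic
import Mathlib.RingTheory.Polynomial.ContentIdeal
import HarnessLib

/-!
# Chudnovsky's theorem on periods — heights bookkeeping and the algebraic envelope

Topic `Literature/NumberTheory/Transcendental` (trunk T-TRANSCEND). Node [HT] of the proof of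
`Literature.NumberTheory.Transcendental.Chudnovsky1984_thm_7_3_1` (Chudnovsky 1984, Ch. 7, Theorem 3.1): the *definitions*
used by the arithmetic half of Gelfond's method (Siegel's lemma, the norm to `ℤ[θ]`, Gelfond's
criterion), with their basic API. All estimates proper are proved in the (definition-free)
companion files.

Gelfond's method needs, besides the analytic upper bound, crude arithmetic upper bounds: the
degrees and heights of all integer polynomials that occur must be `O(L)` and `exp O(L log L)`
(Chudnovsky 1984, Ch. 7, §2, p. 306: "`P(x) ∈ ℤ[x]`, `d(P) ≤ c₁ D`; `H(P) ≤ exp(c₂ D log D)`").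
The bookkeeping device is the **weighted `ℓ¹`-norm** `wnorm ν P = ∑_α ν(coeff_α P)` of a
polynomial with respect to a ring seminorm `ν` on the coefficients (Mathlib `RingSeminorm`): it is
again a ring seminorm (`l1Seminorm`, `pl1Seminorm`), so the construction nests
(`ℤ ⊂ ℤ[T] ⊂ ℤ[T][a₀, …, a₃]`, `ℤ ⊂ ℤ[a] ⊂ ℤ[a][X₀, X₁, X₂]`) with no degree factors.

The second half of the file fixes the shape in which the hypothesis "`trdeg ≤ 1`" enters the
proof. If `θ` is transcendental and `x₀, …, x₃` are algebraic over `ℚ(θ)`, the field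
`K = ℚ(θ)(x₀, …, x₃)` has a `ℚ(θ)`-basis `β₁, …, β_d`, and multiplication by `x_l` is a matrix
`M_l ∈ M_d(ℚ(θ))` (regular representation); clearing denominators, `b(θ) M_l = N_l(θ)` with
`N_l ∈ M_d(ℤ[T])`, `b ∈ ℤ[T]`. An `Envelope θ x` records exactly the consequences used later:
the common eigenvector relation `β N_l(θ) = b(θ) x_l β` (which turns polynomial identities in
`M_d(ℤ[T])` into identities between complex numbers — Siegel's lemma is applied to the former) and
the non-vanishing of `det` of the representing matrix of a nonzero element (the norm from `K` to
`ℚ(θ)`, which produces the polynomials `P_N ∈ ℤ[T]` fed into Gelfond's criterion). The existence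
of an envelope is proved in `ChudnovskyEnvelope.lean`.

## Contents

* `wnorm ν P` (`P : MvPolynomial σ R`, `ν : RingSeminorm R`) and its API (`wnorm_add_le`,
  `wnorm_mul_le`, `wnorm_sum_le`, `wnorm_prod_le`, `le_wnorm`, …); `l1Seminorm ν` — `wnorm ν` as a
  `RingSeminorm (MvPolynomial σ R)`.
* `pwnorm ν p` (`p : R[X]`), same API, `pl1Seminorm ν : RingSeminorm R[X]` (the `ℓ¹`-norm or
  "length" of a polynomial, listed as a TODO in Mathlib's `Analysis/Polynomial/Norm.lean`);
  `zl1` — the case `ℤ[T]`, `supNorm_le_zl1` (link with Mathlib's height `Polynomial.supNorm` used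
  by `Polynomial.gelfondType`), `coeff_sum_monomial_fin`.
* `norm_eval₂_le` / `norm_peval₂_le` — `‖P(w)‖ ≤ wnorm ν P · M^{deg P}` for a ring map `φ` into
  `ℂ` dominated by `ν`.
* `monoEval N α`, `homEval N b n P` — ordered evaluation of a monomial / `b`-homogenised evaluation
  of `P ∈ R[a₀, …, a₃]` at four matrices `N_l ∈ M_d(R)`; linearity and naturality.
* `evC θ x` — the specialisation `ℤ[T][a₀, …, a₃] → ℂ`, `T ↦ θ`, `a ↦ x`.
* `Envelope θ x` — the structure described above; `Envelope.vecMul_homEval` — the eigenvector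
  relation extended to `homEval`.
-/

noncomputable section

open MvPolynomial Finset
open scoped Polynomial

namespace Literature.NumberTheory.Transcendental.Chudnovsky

/-! ### The weighted `ℓ¹`-norm on multivariate polynomials -/

section WNorm

variable {σ R : Type*} [CommRing R] (ν : RingSeminorm R)

/-- The weighted `ℓ¹`-norm `∑_α ν(coeff_α P)` of a multivariate polynomial with respect to a ring
seminorm `ν` on the coefficient ring. [folklore] -/
def wnorm (P : MvPolynomial σ R) : ℝ := ∑ α ∈ P.support, ν (P.coeff α)

/-- The sum defining `wnorm` may be taken over any finite set containing the support. [folklore] -/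
lemma wnorm_eq_sum_of_subset {P : MvPolynomial σ R} {S : Finset (σ →₀ ℕ)}
    (h : P.support ⊆ S) : wnorm ν P = ∑ α ∈ S, ν (P.coeff α) := by
  unfold wnorm
  refine Finset.sum_subset h fun α _ hα => ?_
  rw [notMem_support_iff.mp hα, map_zero]

/-- `wnorm ν P ≥ 0`. [folklore] -/
lemma wnorm_nonneg (P : MvPolynomial σ R) : 0 ≤ wnorm ν P :=
  Finset.sum_nonneg fun _ _ => apply_nonneg _ _

/-- `wnorm ν 0 = 0`. [folklore] -/
@[simp] lemma wnorm_zero : wnorm ν (0 : MvPolynomial σ R) = 0 := by simp [wnorm]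

/-- `wnorm ν (monomial α c) = ν c`. [folklore] -/
lemma wnorm_monomial (α : σ →₀ ℕ) (c : R) : wnorm ν (monomial α c) = ν c := by
  classical
  rw [wnorm_eq_sum_of_subset ν (support_monomial_subset (s := α) (a := c))]
  simp

/-- `wnorm ν (C c) = ν c`. [folklore] -/
lemma wnorm_C (c : R) : wnorm ν (C c : MvPolynomial σ R) = ν c :=
  wnorm_monomial ν 0 c

/-- `wnorm ν (X i) = ν 1`. [folklore] -/
lemma wnorm_X (i : σ) : wnorm ν (X i : MvPolynomial σ R) = ν 1 :=
  wnorm_monomial ν _ _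

/-- `wnorm ν 1 = ν 1`. [folklore] -/
lemma wnorm_one : wnorm ν (1 : MvPolynomial σ R) = ν 1 := by
  rw [← C_1, wnorm_C]

/-- The size of a single coefficient is at most the weighted norm. [folklore] -/
lemma le_wnorm (P : MvPolynomial σ R) (α : σ →₀ ℕ) : ν (P.coeff α) ≤ wnorm ν P := by
  classical
  by_cases h : α ∈ P.support
  · exact Finset.single_le_sum (fun β _ => apply_nonneg ν (P.coeff β)) h
  · rw [notMem_support_iff.mp h, map_zero]
    exact wnorm_nonneg ν P

/-- Subadditivity: `wnorm ν (P + Q) ≤ wnorm ν P + wnorm ν Q`. [folklore] -/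
lemma wnorm_add_le (P Q : MvPolynomial σ R) : wnorm ν (P + Q) ≤ wnorm ν P + wnorm ν Q := by
  classical
  rw [wnorm_eq_sum_of_subset ν (support_add (p := P) (q := Q)),
    wnorm_eq_sum_of_subset ν (Finset.subset_union_left (s₁ := P.support) (s₂ := Q.support)),
    wnorm_eq_sum_of_subset ν (Finset.subset_union_right (s₁ := P.support) (s₂ := Q.support)),
    ← Finset.sum_add_distrib]
  exact Finset.sum_le_sum fun α _ => by rw [coeff_add]; exact map_add_le_add _ _ _

/-- `(-P).support = P.support`. [folklore] -/
lemma support_neg' (P : MvPolynomial σ R) : (-P).support = P.support := by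
  ext α
  simp [mem_support_iff]

/-- `wnorm ν (-P) = wnorm ν P`. [folklore] -/
@[simp] lemma wnorm_neg (P : MvPolynomial σ R) : wnorm ν (-P) = wnorm ν P := by
  unfold wnorm
  rw [support_neg']
  exact Finset.sum_congr rfl fun α _ => by rw [coeff_neg, map_neg_eq_map]

/-- `wnorm ν (P - Q) ≤ wnorm ν P + wnorm ν Q`. [folklore] -/
lemma wnorm_sub_le (P Q : MvPolynomial σ R) : wnorm ν (P - Q) ≤ wnorm ν P + wnorm ν Q := by
  rw [sub_eq_add_neg]
  exact (wnorm_add_le ν P _).trans (by rw [wnorm_neg])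

/-- `wnorm ν (∑ f) ≤ ∑ wnorm ν f`. [folklore] -/
lemma wnorm_sum_le {ι : Type*} (s : Finset ι) (f : ι → MvPolynomial σ R) :
    wnorm ν (∑ i ∈ s, f i) ≤ ∑ i ∈ s, wnorm ν (f i) := by
  classical
  induction s using Finset.induction_on with
  | empty => simp
  | insert a s ha ih =>
    rw [Finset.sum_insert ha, Finset.sum_insert ha]
    exact (wnorm_add_le ν _ _).trans (by linarith)

/-- Submultiplicativity: `wnorm ν (P Q) ≤ wnorm ν P · wnorm ν Q` (expand `P Q` as a double sum
of monomials). [folklore] -/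
lemma wnorm_mul_le (P Q : MvPolynomial σ R) : wnorm ν (P * Q) ≤ wnorm ν P * wnorm ν Q := by
  classical
  have hPQ : P * Q =
      ∑ α ∈ P.support, ∑ β ∈ Q.support, monomial (α + β) (P.coeff α * Q.coeff β) := by
    conv_lhs => rw [P.as_sum, Q.as_sum]
    rw [Finset.sum_mul]
    refine Finset.sum_congr rfl fun α _ => ?_
    rw [Finset.mul_sum]
    refine Finset.sum_congr rfl fun β _ => ?_
    rw [monomial_mul]
  rw [hPQ]
  calc wnorm ν (∑ α ∈ P.support, ∑ β ∈ Q.support, monomial (α + β) (P.coeff α * Q.coeff β))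
      ≤ ∑ α ∈ P.support, wnorm ν (∑ β ∈ Q.support, monomial (α + β) (P.coeff α * Q.coeff β)) :=
        wnorm_sum_le ν _ _
    _ ≤ ∑ α ∈ P.support, ∑ β ∈ Q.support, wnorm ν (monomial (α + β) (P.coeff α * Q.coeff β)) :=
        Finset.sum_le_sum fun α _ => wnorm_sum_le ν _ _
    _ ≤ ∑ α ∈ P.support, ∑ β ∈ Q.support, ν (P.coeff α) * ν (Q.coeff β) := by
        refine Finset.sum_le_sum fun α _ => Finset.sum_le_sum fun β _ => ?_
        rw [wnorm_monomial]
        exact map_mul_le_mul _ _ _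
    _ = wnorm ν P * wnorm ν Q := by
        rw [wnorm, wnorm, Finset.sum_mul_sum]

/-- `wnorm ν (P^n) ≤ (wnorm ν P)^n` provided `ν 1 ≤ 1`. [folklore] -/
lemma wnorm_pow_le (h1 : ν 1 ≤ 1) (P : MvPolynomial σ R) (n : ℕ) :
    wnorm ν (P ^ n) ≤ wnorm ν P ^ n := by
  induction n with
  | zero => rw [pow_zero, pow_zero, wnorm_one]; exact h1
  | succ n ih =>
    rw [pow_succ, pow_succ]
    exact (wnorm_mul_le ν _ _).trans (mul_le_mul_of_nonneg_right ih (wnorm_nonneg ν P))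

/-- `wnorm ν (∏ f) ≤ ∏ wnorm ν f` provided `ν 1 ≤ 1`. [folklore] -/
lemma wnorm_prod_le (h1 : ν 1 ≤ 1) {ι : Type*} (s : Finset ι) (f : ι → MvPolynomial σ R) :
    wnorm ν (∏ i ∈ s, f i) ≤ ∏ i ∈ s, wnorm ν (f i) := by
  classical
  induction s using Finset.induction_on with
  | empty => simpa [wnorm_one] using h1
  | insert a s ha ih =>
    rw [Finset.prod_insert ha, Finset.prod_insert ha]
    exact (wnorm_mul_le ν _ _).trans (mul_le_mul_of_nonneg_left ih (wnorm_nonneg ν _))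

/-- `wnorm ν (X i ^ n) ≤ 1` provided `ν 1 ≤ 1`. [folklore] -/
lemma wnorm_X_pow_le (h1 : ν 1 ≤ 1) (i : σ) (n : ℕ) :
    wnorm ν ((X i : MvPolynomial σ R) ^ n) ≤ 1 :=
  (wnorm_pow_le ν h1 _ n).trans (by rw [wnorm_X]; exact pow_le_one₀ (apply_nonneg _ _) h1)

/-- The weighted `ℓ¹`-norm is a ring seminorm on the polynomial ring (so the construction
nests). [folklore] -/
def l1Seminorm : RingSeminorm (MvPolynomial σ R) where
  toFun := wnorm ν
  map_zero' := wnorm_zero ν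
  add_le' := wnorm_add_le ν
  neg' := wnorm_neg ν
  mul_le' := wnorm_mul_le ν

/-- `l1Seminorm ν P = wnorm ν P`. [folklore] -/
@[simp] lemma l1Seminorm_apply (P : MvPolynomial σ R) : l1Seminorm ν P = wnorm (σ := σ) ν P := rfl

/-- Under a coefficient map `ψ` with `ν' (ψ a) ≤ ν a` (e.g. an isometric inclusion) the weighted
norm does not increase: `wnorm ν' (map ψ P) ≤ wnorm ν P`. [folklore] -/
lemma wnorm_map_le {S : Type*} [CommRing S] (ν' : RingSeminorm S) (ψ : R →+* S)
    (hψ : ∀ a, ν' (ψ a) ≤ ν a) (P : MvPolynomial σ R) :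
    wnorm ν' (MvPolynomial.map ψ P) ≤ wnorm ν P := by
  classical
  rw [wnorm_eq_sum_of_subset ν' (support_map_subset ψ P), wnorm]
  exact Finset.sum_le_sum fun α _ => by rw [MvPolynomial.coeff_map]; exact hψ _

/-- **Evaluation bound.** If `‖φ a‖ ≤ ν a` for the ring map `φ : R → ℂ`, `‖w_i‖ ≤ M` and `1 ≤ M`,
then `‖P^φ(w)‖ ≤ wnorm ν P · M^{deg P}`. [folklore] -/
theorem norm_eval₂_le (φ : R →+* ℂ) (hφ : ∀ a, ‖φ a‖ ≤ ν a) (P : MvPolynomial σ R) (w : σ → ℂ)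
    {M : ℝ} (hM : 1 ≤ M) (hw : ∀ i, ‖w i‖ ≤ M) :
    ‖eval₂ φ w P‖ ≤ wnorm ν P * M ^ P.totalDegree := by
  classical
  rw [eval₂_eq]
  unfold wnorm
  rw [Finset.sum_mul]
  refine (norm_sum_le _ _).trans (Finset.sum_le_sum fun α hα => ?_)
  have hdeg : (α.sum fun _ e => e) ≤ P.totalDegree := le_totalDegree hα
  rw [norm_mul]
  refine mul_le_mul (hφ _) ?_ (norm_nonneg _) (apply_nonneg _ _)
  calc ‖∏ i ∈ α.support, w i ^ α i‖ ≤ ∏ i ∈ α.support, ‖w i ^ α i‖ := norm_prod_le _ _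
    _ ≤ ∏ i ∈ α.support, M ^ α i := by
        refine Finset.prod_le_prod (fun i _ => norm_nonneg _) fun i _ => ?_
        exact (norm_pow_le _ _).trans (pow_le_pow_left₀ (norm_nonneg _) (hw i) _)
    _ = M ^ (α.sum fun _ e => e) := by rw [Finsupp.sum, Finset.prod_pow_eq_pow_sum]
    _ ≤ M ^ P.totalDegree := pow_le_pow_right₀ hM hdeg

end WNorm

/-! ### The weighted `ℓ¹`-norm on univariate polynomials -/

section PWNorm

variable {R : Type*} [CommRing R] (ν : RingSeminorm R)

/-- The weighted `ℓ¹`-norm `∑_i ν(coeff_i p)` of a univariate polynomial. [folklore] -/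
def pwnorm (p : R[X]) : ℝ := ∑ i ∈ p.support, ν (p.coeff i)

/-- The sum defining `pwnorm` may be taken over any finite set containing the support.
[folklore] -/
lemma pwnorm_eq_sum_of_subset {p : R[X]} {S : Finset ℕ} (h : p.support ⊆ S) :
    pwnorm ν p = ∑ i ∈ S, ν (p.coeff i) := by
  unfold pwnorm
  refine Finset.sum_subset h fun i _ hi => ?_
  rw [Polynomial.notMem_support_iff.mp hi, map_zero]

/-- `pwnorm ν p = ∑_{i ≤ deg p} ν (coeff_i p)`. [folklore] -/
lemma pwnorm_eq_sum_range (p : R[X]) :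
    pwnorm ν p = ∑ i ∈ Finset.range (p.natDegree + 1), ν (p.coeff i) :=
  pwnorm_eq_sum_of_subset ν Polynomial.supp_subset_range_natDegree_succ

/-- `pwnorm ν p ≥ 0`. [folklore] -/
lemma pwnorm_nonneg (p : R[X]) : 0 ≤ pwnorm ν p :=
  Finset.sum_nonneg fun _ _ => apply_nonneg _ _

/-- `pwnorm ν 0 = 0`. [folklore] -/
@[simp] lemma pwnorm_zero : pwnorm ν (0 : R[X]) = 0 := by simp [pwnorm]

/-- `pwnorm ν (monomial n c) = ν c`. [folklore] -/
lemma pwnorm_monomial (n : ℕ) (c : R) : pwnorm ν (Polynomial.monomial n c) = ν c := by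
  classical
  rw [pwnorm_eq_sum_of_subset ν (Polynomial.support_monomial_subset n c)]
  simp [Polynomial.coeff_monomial]

/-- `pwnorm ν (C c) = ν c`. [folklore] -/
lemma pwnorm_C (c : R) : pwnorm ν (Polynomial.C c) = ν c := by
  rw [← Polynomial.monomial_zero_left, pwnorm_monomial]

/-- `pwnorm ν X = ν 1`. [folklore] -/
lemma pwnorm_X : pwnorm ν (Polynomial.X : R[X]) = ν 1 := by
  rw [← Polynomial.monomial_one_one_eq_X, pwnorm_monomial]

/-- `pwnorm ν 1 = ν 1`. [folklore] -/
lemma pwnorm_one : pwnorm ν (1 : R[X]) = ν 1 := by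
  rw [← Polynomial.C_1, pwnorm_C]

/-- A single coefficient is bounded by the weighted norm. [folklore] -/
lemma le_pwnorm (p : R[X]) (i : ℕ) : ν (p.coeff i) ≤ pwnorm ν p := by
  classical
  by_cases h : i ∈ p.support
  · exact Finset.single_le_sum (fun j _ => apply_nonneg ν (p.coeff j)) h
  · rw [Polynomial.notMem_support_iff.mp h, map_zero]
    exact pwnorm_nonneg ν p

/-- Subadditivity. [folklore] -/
lemma pwnorm_add_le (p q : R[X]) : pwnorm ν (p + q) ≤ pwnorm ν p + pwnorm ν q := by
  classical
  rw [pwnorm_eq_sum_of_subset ν (Polynomial.support_add (p := p) (q := q)),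
    pwnorm_eq_sum_of_subset ν (Finset.subset_union_left (s₁ := p.support) (s₂ := q.support)),
    pwnorm_eq_sum_of_subset ν (Finset.subset_union_right (s₁ := p.support) (s₂ := q.support)),
    ← Finset.sum_add_distrib]
  exact Finset.sum_le_sum fun i _ => by rw [Polynomial.coeff_add]; exact map_add_le_add _ _ _

/-- `pwnorm ν (-p) = pwnorm ν p`. [folklore] -/
@[simp] lemma pwnorm_neg (p : R[X]) : pwnorm ν (-p) = pwnorm ν p := by
  unfold pwnorm
  rw [Polynomial.support_neg]
  exact Finset.sum_congr rfl fun i _ => by rw [Polynomial.coeff_neg, map_neg_eq_map]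

/-- `pwnorm ν (∑ f) ≤ ∑ pwnorm ν f`. [folklore] -/
lemma pwnorm_sum_le {ι : Type*} (s : Finset ι) (f : ι → R[X]) :
    pwnorm ν (∑ i ∈ s, f i) ≤ ∑ i ∈ s, pwnorm ν (f i) := by
  classical
  induction s using Finset.induction_on with
  | empty => simp
  | insert a s ha ih =>
    rw [Finset.sum_insert ha, Finset.sum_insert ha]
    exact (pwnorm_add_le ν _ _).trans (by linarith)

/-- Submultiplicativity. [folklore] -/
lemma pwnorm_mul_le (p q : R[X]) : pwnorm ν (p * q) ≤ pwnorm ν p * pwnorm ν q := by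
  classical
  have hpq : p * q = ∑ i ∈ p.support, ∑ j ∈ q.support,
      Polynomial.monomial (i + j) (p.coeff i * q.coeff j) := by
    conv_lhs => rw [p.as_sum_support, q.as_sum_support]
    rw [Finset.sum_mul]
    refine Finset.sum_congr rfl fun i _ => ?_
    rw [Finset.mul_sum]
    refine Finset.sum_congr rfl fun j _ => ?_
    rw [Polynomial.monomial_mul_monomial]
  rw [hpq]
  calc pwnorm ν (∑ i ∈ p.support, ∑ j ∈ q.support, Polynomial.monomial (i + j) (p.coeff i * q.coeff j))
      ≤ ∑ i ∈ p.support, pwnorm ν (∑ j ∈ q.support,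
          Polynomial.monomial (i + j) (p.coeff i * q.coeff j)) := pwnorm_sum_le ν _ _
    _ ≤ ∑ i ∈ p.support, ∑ j ∈ q.support,
          pwnorm ν (Polynomial.monomial (i + j) (p.coeff i * q.coeff j)) :=
        Finset.sum_le_sum fun i _ => pwnorm_sum_le ν _ _
    _ ≤ ∑ i ∈ p.support, ∑ j ∈ q.support, ν (p.coeff i) * ν (q.coeff j) := by
        refine Finset.sum_le_sum fun i _ => Finset.sum_le_sum fun j _ => ?_
        rw [pwnorm_monomial]
        exact map_mul_le_mul _ _ _
    _ = pwnorm ν p * pwnorm ν q := by rw [pwnorm, pwnorm, Finset.sum_mul_sum]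

/-- `pwnorm ν (p^n) ≤ (pwnorm ν p)^n` provided `ν 1 ≤ 1`. [folklore] -/
lemma pwnorm_pow_le (h1 : ν 1 ≤ 1) (p : R[X]) (n : ℕ) : pwnorm ν (p ^ n) ≤ pwnorm ν p ^ n := by
  induction n with
  | zero => rw [pow_zero, pow_zero, pwnorm_one]; exact h1
  | succ n ih =>
    rw [pow_succ, pow_succ]
    exact (pwnorm_mul_le ν _ _).trans (mul_le_mul_of_nonneg_right ih (pwnorm_nonneg ν p))

/-- `pwnorm ν (∏ f) ≤ ∏ pwnorm ν f` provided `ν 1 ≤ 1`. [folklore] -/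
lemma pwnorm_prod_le (h1 : ν 1 ≤ 1) {ι : Type*} (s : Finset ι) (f : ι → R[X]) :
    pwnorm ν (∏ i ∈ s, f i) ≤ ∏ i ∈ s, pwnorm ν (f i) := by
  classical
  induction s using Finset.induction_on with
  | empty => simpa [pwnorm_one] using h1
  | insert a s ha ih =>
    rw [Finset.prod_insert ha, Finset.prod_insert ha]
    exact (pwnorm_mul_le ν _ _).trans (mul_le_mul_of_nonneg_left ih (pwnorm_nonneg ν _))

/-- `pwnorm ν (X - C y) ≤ ν 1 + ν y`. [folklore] -/
lemma pwnorm_X_sub_C_le (y : R) :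
    pwnorm ν (Polynomial.X - Polynomial.C y) ≤ ν 1 + ν y := by
  rw [sub_eq_add_neg, ← Polynomial.C_neg]
  refine (pwnorm_add_le ν _ _).trans ?_
  rw [pwnorm_X, pwnorm_C, map_neg_eq_map]

/-- The weighted `ℓ¹`-norm is a ring seminorm on `R[X]`. [folklore] -/
def pl1Seminorm : RingSeminorm R[X] where
  toFun := pwnorm ν
  map_zero' := pwnorm_zero ν
  add_le' := pwnorm_add_le ν
  neg' := pwnorm_neg ν
  mul_le' := pwnorm_mul_le ν

/-- `pl1Seminorm ν p = pwnorm ν p`. [folklore] -/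
@[simp] lemma pl1Seminorm_apply (p : R[X]) : pl1Seminorm ν p = pwnorm ν p := rfl

/-- **Evaluation bound.** If `‖φ a‖ ≤ ν a`, then `‖p^φ(θ)‖ ≤ pwnorm ν p · max(1, ‖θ‖)^{deg p}`.
[folklore] -/
theorem norm_peval₂_le (φ : R →+* ℂ) (hφ : ∀ a, ‖φ a‖ ≤ ν a) (p : R[X]) (θ : ℂ) :
    ‖Polynomial.eval₂ φ θ p‖ ≤ pwnorm ν p * max 1 ‖θ‖ ^ p.natDegree := by
  rw [Polynomial.eval₂_eq_sum_range, pwnorm_eq_sum_range, Finset.sum_mul]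
  refine (norm_sum_le _ _).trans (Finset.sum_le_sum fun i hi => ?_)
  rw [norm_mul, norm_pow]
  refine mul_le_mul (hφ _) ?_ (by positivity) (apply_nonneg _ _)
  calc ‖θ‖ ^ i ≤ max 1 ‖θ‖ ^ i := by gcongr; exact le_max_right _ _
    _ ≤ max 1 ‖θ‖ ^ p.natDegree :=
        pow_le_pow_right₀ (le_max_left _ _) (Nat.lt_succ_iff.mp (Finset.mem_range.mp hi))

end PWNorm

/-- Coefficients of the polynomial `∑_{a<A} t_a T^a` of degree `< A` built from a coefficient
vector `t`. [folklore] -/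
lemma coeff_sum_monomial_fin {R : Type*} [Semiring R] {A : ℕ} (t : Fin A → R) (k : ℕ) :
    (∑ a : Fin A, Polynomial.monomial (a : ℕ) (t a)).coeff k =
      if h : k < A then t ⟨k, h⟩ else 0 := by
  rw [Polynomial.finsetSum_coeff]
  simp only [Polynomial.coeff_monomial]
  split_ifs with h
  · rw [Finset.sum_eq_single ⟨k, h⟩]
    · simp
    · intro a _ ha
      rw [if_neg]
      exact fun h' => ha (Fin.ext h')
    · simp
  · refine Finset.sum_eq_zero fun a _ => ?_
    rw [if_neg]
    intro h'
    exact h (h' ▸ a.2)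

/-! ### Integer coefficients -/

/-- The `ℓ¹`-norm on `ℤ[T]` (`ν = |·|` on `ℤ`). [folklore] -/
abbrev zl1 : RingSeminorm ℤ[X] := pl1Seminorm (normRingSeminorm ℤ)

/-- `normRingSeminorm ℤ a = |a|` (as a real number). [folklore] -/
@[simp] lemma normRingSeminorm_int_apply (a : ℤ) : normRingSeminorm ℤ a = |(a : ℝ)| := by
  change ‖a‖ = _
  rw [Int.norm_eq_abs]

/-- `normRingSeminorm ℤ 1 = 1`. [folklore] -/
lemma normRingSeminorm_int_one : normRingSeminorm ℤ 1 = 1 := by simp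

/-- `zl1 1 = 1`. [folklore] -/
@[simp] lemma zl1_one : zl1 1 = 1 := by
  rw [zl1, pl1Seminorm_apply, pwnorm_one]; simp

/-- `zl1 X = 1`. [folklore] -/
@[simp] lemma zl1_X : zl1 Polynomial.X = 1 := by
  rw [zl1, pl1Seminorm_apply, pwnorm_X]; simp

/-- `zl1 (C a) = |a|`. [folklore] -/
@[simp] lemma zl1_C (a : ℤ) : zl1 (Polynomial.C a) = |(a : ℝ)| := by
  rw [zl1, pl1Seminorm_apply, pwnorm_C]; simp

/-- `zl1 (n : ℤ[T]) = n`. [folklore] -/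
@[simp] lemma zl1_natCast (n : ℕ) : zl1 (n : ℤ[X]) = n := by
  rw [← map_natCast (Polynomial.C : ℤ →+* ℤ[X]) n, zl1_C]; simp

/-- Mathlib's height is dominated by the `ℓ¹`-norm: `H(p) = supNorm p ≤ zl1 p`. [folklore] -/
lemma supNorm_le_zl1 (p : ℤ[X]) : p.supNorm ≤ zl1 p := by
  by_cases hp : p = 0
  · simp [hp]
  · obtain ⟨i, hi⟩ := p.exists_eq_supNorm
    rw [hi, Int.norm_eq_abs]
    have := le_pwnorm (normRingSeminorm ℤ) p i
    simpa using this

/-- `|coeff_i p| ≤ zl1 p`. [folklore] -/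
lemma abs_coeff_le_zl1 (p : ℤ[X]) (i : ℕ) : |(p.coeff i : ℝ)| ≤ zl1 p := by
  simpa using le_pwnorm (normRingSeminorm ℤ) p i

/-- `zl1 p ≤ (deg p + 1) · B` if all coefficients satisfy `|coeff| ≤ B`. [folklore] -/
lemma zl1_le_of_coeff_le (p : ℤ[X]) {B : ℝ} (h : ∀ i, |(p.coeff i : ℝ)| ≤ B) :
    zl1 p ≤ (p.natDegree + 1) * B := by
  rw [zl1, pl1Seminorm_apply, pwnorm_eq_sum_range]
  calc ∑ i ∈ Finset.range (p.natDegree + 1), normRingSeminorm ℤ (p.coeff i)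
      ≤ ∑ _i ∈ Finset.range (p.natDegree + 1), B :=
        Finset.sum_le_sum fun i _ => by simpa using h i
    _ = (p.natDegree + 1) * B := by simp

/-- `‖p(θ)‖ ≤ zl1 p · max(1, ‖θ‖)^{deg p}` for `p ∈ ℤ[T]`. [folklore] -/
theorem norm_aeval_le_zl1 (p : ℤ[X]) (θ : ℂ) :
    ‖Polynomial.aeval θ p‖ ≤ zl1 p * max 1 ‖θ‖ ^ p.natDegree := by
  rw [Polynomial.aeval_def]
  exact norm_peval₂_le _ _ (fun a => by simp) p θ

/-- The `ℓ¹`-norm of an integer polynomial in several variables. [folklore] -/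
abbrev l1 {σ : Type*} (P : MvPolynomial σ ℤ) : ℝ := wnorm (normRingSeminorm ℤ) P

/-- `‖P(w)‖ ≤ l1 P · M^{deg P}` for `‖w_i‖ ≤ M`, `1 ≤ M`. [folklore] -/
theorem norm_aeval_le_l1 {σ : Type*} (P : MvPolynomial σ ℤ) (w : σ → ℂ) {M : ℝ} (hM : 1 ≤ M)
    (hw : ∀ i, ‖w i‖ ≤ M) : ‖MvPolynomial.aeval w P‖ ≤ l1 P * M ^ P.totalDegree := by
  rw [MvPolynomial.aeval_def]
  exact norm_eval₂_le _ _ (fun a => by simp) P w hM hw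

/-! ### Homogenised evaluation at four matrices -/

section HomEval

variable {R S : Type*} [CommRing R] [CommRing S] {d : ℕ}

/-- Ordered evaluation of the monomial `a^α = a₀^{α₀} a₁^{α₁} a₂^{α₂} a₃^{α₃}` at four square
matrices: `N₀^{α₀} N₁^{α₁} N₂^{α₂} N₃^{α₃}` (no commutativity is assumed). [folklore] -/
def monoEval (N : Fin 4 → Matrix (Fin d) (Fin d) R) (α : Fin 4 →₀ ℕ) : Matrix (Fin d) (Fin d) R :=
  N 0 ^ α 0 * N 1 ^ α 1 * N 2 ^ α 2 * N 3 ^ α 3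

/-- `monoEval N 0 = 1`. [folklore] -/
@[simp] lemma monoEval_zero (N : Fin 4 → Matrix (Fin d) (Fin d) R) : monoEval N 0 = 1 := by
  simp [monoEval]

/-- Naturality of `monoEval` under a ring map. [folklore] -/
lemma monoEval_map (φ : R →+* S) (N : Fin 4 → Matrix (Fin d) (Fin d) R) (α : Fin 4 →₀ ℕ) :
    (monoEval N α).map φ = monoEval (fun l => (N l).map φ) α := by
  simp only [monoEval, Matrix.map_mul, Matrix.map_pow]

/-- The **`b`-homogenised evaluation** of `P = ∑_α c_α a^α ∈ R[a₀, …, a₃]` at four matrices: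
`homEval N b n P = ∑_α c_α b^{n - |α|} N^α` (`N^α` the ordered product `monoEval N α`). If
`N_l = b M_l` for commuting `M_l` and `deg P ≤ n`, this is `b^n P(M)`. [folklore] -/
def homEval (N : Fin 4 → Matrix (Fin d) (Fin d) R) (b : R) (n : ℕ) (P : MvPolynomial (Fin 4) R) :
    Matrix (Fin d) (Fin d) R :=
  ∑ α ∈ P.support, (P.coeff α * b ^ (n - α.degree)) • monoEval N α

variable (N : Fin 4 → Matrix (Fin d) (Fin d) R) (b : R) (n : ℕ)

/-- The sum defining `homEval` may be taken over any finite set containing the support.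
[folklore] -/
lemma homEval_eq_sum_of_subset {P : MvPolynomial (Fin 4) R} {T : Finset (Fin 4 →₀ ℕ)}
    (h : P.support ⊆ T) :
    homEval N b n P = ∑ α ∈ T, (P.coeff α * b ^ (n - α.degree)) • monoEval N α := by
  unfold homEval
  refine Finset.sum_subset h fun α _ hα => ?_
  rw [notMem_support_iff.mp hα, zero_mul, zero_smul]

/-- `homEval` of a monomial. [folklore] -/
lemma homEval_monomial (α : Fin 4 →₀ ℕ) (c : R) :
    homEval N b n (monomial α c) = (c * b ^ (n - α.degree)) • monoEval N α := by
  classical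
  rw [homEval_eq_sum_of_subset N b n (support_monomial_subset (s := α) (a := c))]
  simp

/-- `homEval N b n 0 = 0`. [folklore] -/
@[simp] lemma homEval_zero' : homEval N b n (0 : MvPolynomial (Fin 4) R) = 0 := by
  simp [homEval]

/-- Additivity of `homEval`. [folklore] -/
lemma homEval_add (P Q : MvPolynomial (Fin 4) R) :
    homEval N b n (P + Q) = homEval N b n P + homEval N b n Q := by
  classical
  rw [homEval_eq_sum_of_subset N b n (support_add (p := P) (q := Q)),
    homEval_eq_sum_of_subset N b n (Finset.subset_union_left (s₁ := P.support) (s₂ := Q.support)),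
    homEval_eq_sum_of_subset N b n
      (Finset.subset_union_right (s₁ := P.support) (s₂ := Q.support)),
    ← Finset.sum_add_distrib]
  refine Finset.sum_congr rfl fun α _ => ?_
  rw [coeff_add, add_mul, add_smul]

/-- `homEval` of a finite sum. [folklore] -/
lemma homEval_sum {ι : Type*} (s : Finset ι) (f : ι → MvPolynomial (Fin 4) R) :
    homEval N b n (∑ i ∈ s, f i) = ∑ i ∈ s, homEval N b n (f i) := by
  classical
  induction s using Finset.induction_on with
  | empty => simp
  | insert a s ha ih => rw [Finset.sum_insert ha, Finset.sum_insert ha, homEval_add, ih]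

/-- `R`-linearity of `homEval`: `homEval (C c * P) = c • homEval P`. [folklore] -/
lemma homEval_C_mul (c : R) (P : MvPolynomial (Fin 4) R) :
    homEval N b n (C c * P) = c • homEval N b n P := by
  classical
  have hsupp : (C c * P).support ⊆ P.support := by
    intro α hα
    rw [mem_support_iff] at hα ⊢
    rw [coeff_C_mul] at hα
    exact fun h => hα (by rw [h, mul_zero])
  rw [homEval_eq_sum_of_subset N b n hsupp, homEval, Finset.smul_sum]
  refine Finset.sum_congr rfl fun α _ => ?_
  rw [coeff_C_mul, smul_smul, mul_assoc]

/-- Naturality of `homEval` under a ring map `φ`. [folklore] -/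
lemma homEval_map (φ : R →+* S) (P : MvPolynomial (Fin 4) R) :
    (homEval N b n P).map φ =
      homEval (fun l => (N l).map φ) (φ b) n (MvPolynomial.map φ P) := by
  classical
  rw [homEval_eq_sum_of_subset _ _ n (support_map_subset φ P), homEval]
  change φ.mapMatrix (∑ α ∈ P.support, (P.coeff α * b ^ (n - α.degree)) • monoEval N α) = _
  rw [map_sum]
  refine Finset.sum_congr rfl fun α _ => ?_
  rw [MvPolynomial.coeff_map, ← monoEval_map]
  ext i j
  simp only [RingHom.mapMatrix_apply, Matrix.map_apply, Matrix.smul_apply, smul_eq_mul, map_mul,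
    map_pow]

end HomEval

/-! ### The algebraic envelope of `(θ; x₀, …, x₃)` -/

/-- The specialisation `ℤ[T][a₀, …, a₃] → ℂ`, `T ↦ θ`, `a_l ↦ x_l`. [folklore] -/
def evC (θ : ℂ) (x : Fin 4 → ℂ) : MvPolynomial (Fin 4) ℤ[X] →+* ℂ :=
  MvPolynomial.eval₂Hom (Polynomial.aeval θ : ℤ[X] →ₐ[ℤ] ℂ).toRingHom x

/-- `evC` on coefficients: `evC θ x (C p) = p(θ)`. [folklore] -/
@[simp] lemma evC_C (θ : ℂ) (x : Fin 4 → ℂ) (p : ℤ[X]) :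
    evC θ x (C p) = Polynomial.aeval θ p := by
  simp [evC]

/-- `evC` on variables: `evC θ x (X l) = x_l`. [folklore] -/
@[simp] lemma evC_X (θ : ℂ) (x : Fin 4 → ℂ) (l : Fin 4) : evC θ x (X l) = x l := by
  simp [evC]

/-- `evC` of an integer polynomial (coefficients in `ℤ ⊂ ℤ[T]`) is its value at `x`. [folklore] -/
lemma evC_map_C (θ : ℂ) (x : Fin 4 → ℂ) (V : MvPolynomial (Fin 4) ℤ) :
    evC θ x (MvPolynomial.map (Polynomial.C : ℤ →+* ℤ[X]) V) = MvPolynomial.aeval x V := by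
  have h : (Polynomial.aeval θ : ℤ[X] →ₐ[ℤ] ℂ).toRingHom.comp (Polynomial.C : ℤ →+* ℤ[X]) =
      algebraMap ℤ ℂ := RingHom.ext_int _ _
  rw [evC, MvPolynomial.eval₂Hom_map_hom, h, MvPolynomial.aeval_def, MvPolynomial.coe_eval₂Hom]

/-- An **algebraic envelope** of a point `(θ; x₀, …, x₃) ∈ ℂ × ℂ⁴`: the data produced from a
transcendental `θ` and numbers `x_l` algebraic over `ℚ(θ)` by the regular representation of the
field `K = ℚ(θ)(x₀, …, x₃)` on a `ℚ(θ)`-basis `β₁, …, β_d` after clearing denominators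
(`N_l(θ) = b(θ) · (matrix of x_l)`), keeping only what Gelfond's method uses:
* `eigen` — `β` is a common row eigenvector: `∑_i β_i N_l(θ)_{ij} = b(θ) x_l β_j`;
* `det_ne` — for `P ∈ ℤ[T][a]` of degree `≤ n` with `P(θ; x) ≠ 0`, the determinant of the
  `b`-homogenised representing matrix `homEval N b n P` does not vanish at `θ` (it is
  `b(θ)^{nd} · N_{K/ℚ(θ)}(P(θ; x))`).
Existence under the hypotheses above is `exists_envelope` (`ChudnovskyEnvelope.lean`). [folklore] -/
structure Envelope (θ : ℂ) (x : Fin 4 → ℂ) where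
  /-- the degree `d = [K : ℚ(θ)]` -/
  d : ℕ
  d_pos : 0 < d
  /-- the numerators of the regular representation: `N_l(θ) = b(θ) · (matrix of x_l)` -/
  N : Fin 4 → Matrix (Fin d) (Fin d) ℤ[X]
  /-- the common denominator -/
  b : ℤ[X]
  aeval_b_ne : Polynomial.aeval θ b ≠ 0
  /-- the basis `β₁, …, β_d` of `K/ℚ(θ)`, as complex numbers -/
  β : Fin d → ℂ
  β_ne : β ≠ 0
  eigen : ∀ l : Fin 4,
    Matrix.vecMul β ((N l).map (Polynomial.aeval θ : ℤ[X] →ₐ[ℤ] ℂ)) =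
      (Polynomial.aeval θ b * x l) • β
  det_ne : ∀ (n : ℕ) (P : MvPolynomial (Fin 4) ℤ[X]), (∀ α ∈ P.support, α.degree ≤ n) →
    evC θ x P ≠ 0 → Polynomial.aeval θ (homEval N b n P).det ≠ 0

namespace Envelope

variable {θ : ℂ} {x : Fin 4 → ℂ} (E : Envelope θ x)

/-- The matrices `N_l(θ) ∈ M_d(ℂ)`. [folklore] -/
abbrev Nθ (l : Fin 4) : Matrix (Fin E.d) (Fin E.d) ℂ :=
  (E.N l).map (Polynomial.aeval θ : ℤ[X] →ₐ[ℤ] ℂ)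

/-- A common row eigenvector of `A` with eigenvalue `a` is one of `A^k` with eigenvalue `a^k`.
[folklore] -/
lemma vecMul_pow_of_vecMul {m : Type*} [Fintype m] [DecidableEq m] {v : m → ℂ}
    {A : Matrix m m ℂ} {a : ℂ} (h : Matrix.vecMul v A = a • v) (k : ℕ) :
    Matrix.vecMul v (A ^ k) = a ^ k • v := by
  induction k with
  | zero => simp
  | succ k ih =>
    rw [pow_succ, ← Matrix.vecMul_vecMul, ih, Matrix.smul_vecMul, h, smul_smul, ← pow_succ]

/-- The eigenvector relation for ordered monomials: `β N(θ)^α = (b(θ))^{|α|} x^α β`. [folklore] -/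
lemma vecMul_monoEval (α : Fin 4 →₀ ℕ) :
    Matrix.vecMul E.β (monoEval E.Nθ α) =
      ((Polynomial.aeval θ E.b) ^ α.degree * ∏ l, x l ^ α l) • E.β := by
  have h := fun l => vecMul_pow_of_vecMul (E.eigen l)
  simp only [monoEval, ← Matrix.vecMul_vecMul, h, Matrix.smul_vecMul, smul_smul]
  congr 1
  rw [Finsupp.degree_eq_sum, Fin.sum_univ_four, Fin.prod_univ_four]
  ring

/-- **The eigenvector relation for `homEval`.** If every monomial of `P ∈ ℤ[T][a]` has degree
`≤ n`, then `β · (homEval N b n P)(θ) = b(θ)^n P(θ; x) · β`. [folklore] -/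
theorem vecMul_homEval {n : ℕ} {P : MvPolynomial (Fin 4) ℤ[X]}
    (hP : ∀ α ∈ P.support, α.degree ≤ n) :
    Matrix.vecMul E.β ((homEval E.N E.b n P).map (Polynomial.aeval θ : ℤ[X] →ₐ[ℤ] ℂ)) =
      ((Polynomial.aeval θ E.b) ^ n * evC θ x P) • E.β := by
  classical
  set φ : ℤ[X] →+* ℂ := (Polynomial.aeval θ : ℤ[X] →ₐ[ℤ] ℂ).toRingHom with hφ
  have hmap : (homEval E.N E.b n P).map (Polynomial.aeval θ : ℤ[X] →ₐ[ℤ] ℂ) =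
      (homEval E.N E.b n P).map φ := rfl
  rw [hmap, homEval_map, homEval_eq_sum_of_subset _ _ n (support_map_subset φ P),
    Matrix.vecMul_sum]
  have hev : evC θ x P = ∑ α ∈ P.support, φ (P.coeff α) * ∏ l, x l ^ α l := by
    rw [evC, MvPolynomial.coe_eval₂Hom, MvPolynomial.eval₂_eq]
    refine Finset.sum_congr rfl fun α _ => ?_
    congr 1
    rw [Finset.prod_subset (Finset.subset_univ α.support)]
    intro l _ hl
    rw [Finsupp.notMem_support_iff.mp hl, pow_zero]
  rw [hev, Finset.mul_sum, Finset.sum_smul]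
  refine Finset.sum_congr rfl fun α hα => ?_
  rw [Matrix.vecMul_smul, MvPolynomial.coeff_map]
  change (φ (P.coeff α) * φ E.b ^ (n - α.degree)) • Matrix.vecMul E.β (monoEval E.Nθ α) = _
  rw [vecMul_monoEval, smul_smul]
  congr 1
  have hdeg := hP α hα
  have : φ E.b = Polynomial.aeval θ E.b := rfl
  rw [this, ← mul_assoc, mul_assoc (φ (P.coeff α)), ← pow_add, Nat.sub_add_cancel hdeg]
  ring

/-- Consequence used with Siegel's lemma: a polynomial identity `homEval N b n P = 0` in
`M_d(ℤ[T])` forces the complex number `P(θ; x)` to vanish. [folklore] -/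
theorem evC_eq_zero_of_homEval_eq_zero {n : ℕ} {P : MvPolynomial (Fin 4) ℤ[X]}
    (hP : ∀ α ∈ P.support, α.degree ≤ n) (h0 : homEval E.N E.b n P = 0) : evC θ x P = 0 := by
  have h := E.vecMul_homEval hP
  rw [h0] at h
  simp only [Matrix.map_zero, map_zero, Matrix.vecMul_zero] at h
  obtain ⟨i, hi⟩ := Function.ne_iff.mp E.β_ne
  have := congr_fun h i
  simp only [Pi.zero_apply, Pi.smul_apply, smul_eq_mul] at this
  rcases mul_eq_zero.mp this.symm with h1 | h1
  · rcases mul_eq_zero.mp h1 with h2 | h2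
    · exact absurd (pow_eq_zero_iff'.mp h2).1 E.aeval_b_ne
    · exact h2
  · exact absurd h1 hi

end Envelope

end Literature.NumberTheory.Transcendental.Chudnovsky

end
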